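import Literature.AlgebraicGeometry.Resolution.FundamentalInequality
import Literature.AlgebraicGeometry.Resolution.TranscendenceDefect
import HarnessLib

/-!
# Ramification index, inertia degree, defectless and stable valued fields (Temkin 2013, §2.1; Kuhlmann 2010, §1)

Topic: `Literature/AlgebraicGeometry/Resolution` (valued function fields). DEFINITIONS, one
PROVED theorem and one NAMED FACT one layer below the named fact `Temkin2013Abhyankar`
(`InseparableLocalUniformizationAbhyankar.lean` = M. Temkin, *Inseparable local uniformization*,
J. Algebra 373 (2013) 65–119 = arXiv:0804.1554v3, Thm. 5.5.2 (i)): the vocabulary of §2.1 of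
the source (p. 9: "If `n = [l : k]` is finite then it is standard to introduce the numbers
`e = e_{l/k} = #|l^×|/|k^×|` and `f = f_{l/k} = [l̃ : k̃]` … An easy classical result states
that `ef ≤ n` … If, more generally, the valuation of `k` admits `m` extensions to `l` and
`e₁, …, e_m, f₁, …, f_m` are the corresponding invariants of the extensions of valued fields then
`e₁f₁ + ⋯ + e_m f_m ≤ n` and the extension is called defectless when equality holds. A valued
field `k` is called stable if any finite extension is defectless"), and the **generalized
stability theorem** on which §5 of the source rests (Remark 2.1.3, p. 10: "We will also need
the following difficult result called the (generalized) stability theorem: if `k` is stable then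
`l` is stable. We refer to a very recent paper [Kuh] for a proof"; [Kuh] = F.-V. Kuhlmann,
*Elimination of ramification I: The generalized stability theorem*, Trans. AMS 362 (2010)
5697–5727 = arXiv:1003.5678, Thm. 1.1), used in §5.1 (p. 52: "since the extension `K/K_B` is
defectless by the stability theorem"), in the proof of Thm. 5.5.1 (p. 59: "`K_B` is stable by
Remark 2.1.3") and of Thm. 5.5.3 (p. 61).

## Content

* `valueSubgroup K O'` (`mem_valueSubgroup_iff`) — `|K^×| ⊆ |L^×|` for `K → L` and `O' = L°`;
  `ramificationIndex K O'` — `e = #(|L^×|/|K^×|)` (`Subgroup.index`); `residueSubfield K O'`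
  (`mem_residueSubfield_iff`: exactly the residues of `K ∩ L°`) — `K̃ ⊆ L̃`;
  `inertiaDegree K O'` — `f = [L̃ : K̃]` (`Module.finrank`). DEFINITIONS.
* `ramificationIndex_mul_inertiaDegree_le_finrank` — **`e·f ≤ n`** for one extension of the
  valuation, `L/K` finite (from `FundamentalInequality.lean`). PROVED.
* `IsDefectlessIn K O L` — `∑ᵢ eᵢ fᵢ = [L : K]` over all extensions of `K°` to `L`;
  `IsDefectlessField K O` — defectless (= stable) in every finite extension. DEFINITIONS
  (two-argument PREDICATES on a valued field `(K, O)`, NOT named facts: `IsDefectlessField K O`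
  holds for the trivial valuation — `isDefectlessField_top`, `ValuationDefectProofs.lean` — and
  FAILS for F. K. Schmidt's example — `not_forall_isDefectlessField :
  ¬ ∀ K O, IsDefectlessField K O`, `ValuationDefectExample.lean`; verdict clean-up 2026-08-16:
  the predicate had been mis-indexed as a closed named fact awaiting a discharge
  `IsDefectlessField_holds`, which is ill-typed; its statement is unchanged, only its binders
  were made explicit); `isDefectlessIn_self` — sanity check on `L = K` (`e = f = 1`). PROVED.
* `Kuhlmann2010Stability` — NAMED FACT: Kuhlmann's Thm. 1.1 over a trivially valued (hence
  defectless) ground field: `K/k` finitely generated, `k ⊆ K°`, `D_{K/k} = 0` ⇒ `(K, K°)` is a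
  defectless field (DISCHARGED downstream: `Kuhlmann2010Stability_holds`,
  `GeneralizedStabilityHolds.lean`).

## Sources

* M. Temkin, *Inseparable local uniformization*, J. Algebra 373 (2013) = arXiv:0804.1554v3:
  §2.1 (p. 9), Remark 2.1.3 (p. 10), §5.1 (p. 52), proofs of Thms. 5.5.1, 5.5.3 (pp. 59–61).
* F.-V. Kuhlmann, *Elimination of ramification I: The generalized stability theorem*, Trans.
  Amer. Math. Soc. 362 (2010) 5697–5727 = arXiv:1003.5678: §1, p. 3 (fundamental inequality,
  "defectless in `L`", "defectless (or stable) field", "Note that every trivially valued field is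
  a defectless field"), Thm. 1.1.

## Rendering notes

* An extension `l/k` of valued fields (Temkin: "an inclusion `k ↪ l` … `l° ∩ k = k°`") is a field
  map `algebraMap K L` together with a valuation ring `O' = L°` of `L`; the valuation ring of `K`
  is then `O'.comap (algebraMap K L)`, and "the extensions of `K°` to `L`" are the `O'` with
  `O'.comap (algebraMap K L) = K°`. Their finiteness (at most `[L : K]` of them) is not proved here;
  `IsDefectlessIn` asks for a finite set consisting exactly of them, which makes the finiteness
  part of the (true) statement rather than a prerequisite of its formulation.
* `e` and `f` are rendered by `Subgroup.index` and `Module.finrank`, both `0` in the infinite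
  case; for `L/K` finite they are positive and `e·f ≤ [L : K]`
  (`ramificationIndex_mul_inertiaDegree_le_finrank`), so the convention never interferes with
  `IsDefectlessIn` for finite extensions, the only case in which the sources use it.
* "Valued function field without transcendence defect" over a TRIVIALLY valued `k` ↦ `K/k`
  finitely generated with `k ⊆ K°` and `transcendenceDefect k O hk = 0` (`TranscendenceDefect.lean`;
  Kuhlmann's hypothesis "equality holds in the Abhyankar inequality" with `vK = 0`, `Kv = k`). The
  general theorem (arbitrary defectless base `(K, v)`) needs the relative invariants `E_{F/K}`,
  `F_{F/K}`, which are not rendered; only the special case used by Temkin is vendored.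
-/

noncomputable section

namespace Literature.AlgebraicGeometry.Resolution

open IsLocalRing

universe u

section Invariants

variable (K : Type u) {L : Type u} [Field K] [Field L] [Algebra K L] (O' : ValuationSubring L)

/-- **`|K^×|` inside `|L^×|`** for an extension `K → L` of fields and a valuation ring `O' = L°`
of `L` (inducing `K° = O' ∩ K` on `K`; Temkin 2013, §2.1, p. 9: "By extension `l/k` of valued
fields we mean an inclusion `k ↪ l` which respects the valuations in the sense that
`l° ∩ k = k°`"): the subgroup of the value group `|L^×| = (ValueGroup O')ˣ` of values of the
non-zero elements of `K`. [cite: Temkin2013, Section 2.1 (p. 9)] -/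
def valueSubgroup : Subgroup (ValuationSubring.ValueGroup O')ˣ :=
  ((Units.map (O'.valuation.toMonoidHom)).comp
    (Units.map ((algebraMap K L : K →+* L) : K →* L))).range

/-- Membership in `|K^×| ⊆ |L^×|`: the values of non-zero elements of `K`. [folklore] -/
theorem mem_valueSubgroup_iff (γ : (ValuationSubring.ValueGroup O')ˣ) :
    γ ∈ valueSubgroup K O' ↔
      ∃ c : K, c ≠ 0 ∧ (γ : ValuationSubring.ValueGroup O') = O'.valuation (algebraMap K L c) := by
  constructor
  · rintro ⟨u, rfl⟩
    exact ⟨(u : K), u.ne_zero, rfl⟩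
  · rintro ⟨c, hc, hγ⟩
    refine ⟨Units.mk0 c hc, Units.ext ?_⟩
    rw [hγ]
    rfl

/-- **Ramification index `e = e_{L/K} = #(|L^×|/|K^×|)`** (Temkin 2013, §2.1, p. 9: "If
`n = [l : k]` is finite then it is standard to introduce the numbers `e = e_{l/k} = #|l^×|/|k^×|`
and `f = f_{l/k} = [l̃ : k̃]`"; Kuhlmann 2010, p. 3: "`eᵢ = (vᵢL : vK)` are the respective
ramification indices") of the valuation ring `O' = L°` over `K`: the index of `|K^×|` in
`|L^×|` (Mathlib's `Subgroup.index`, which is `0` for an infinite index; the index is finite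
and `≤ [L : K]` for `L/K` finite, `ramificationIndex_mul_inertiaDegree_le_finrank`).
[cite: Temkin2013, Section 2.1 (p. 9)] -/
def ramificationIndex : ℕ :=
  (valueSubgroup K O').index

/-- **`K̃ ⊆ L̃`**: the residue field of `K° = O' ∩ K` as a subfield of the residue field `L̃` of
`O'`, i.e. the subfield of residues of the elements of `K` lying in `O'` (defined as the subfield
generated by these residues, which form a subfield already). [cite: Temkin2013, Section 2.1 (p. 9)] -/
def residueSubfield : Subfield (ResidueField O') :=
  Subfield.closure {r | ∃ (c : K) (h : algebraMap K L c ∈ O'), residue O' ⟨algebraMap K L c, h⟩ = r}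

/-- Residues of elements of `K ∩ L°` lie in `K̃ ⊆ L̃`. [folklore] -/
theorem residue_mem_residueSubfield (c : K) (h : algebraMap K L c ∈ O') :
    residue O' ⟨algebraMap K L c, h⟩ ∈ residueSubfield K O' :=
  Subfield.subset_closure ⟨c, h, rfl⟩

/-- `K̃ ⊆ L̃` consists EXACTLY of the residues of the elements of `K ∩ L°` (these form a subfield:
a non-zero residue comes from a unit `c` of `K°`, and `c⁻¹ ∈ K°` reduces to the inverse).
[folklore] -/
theorem mem_residueSubfield_iff (r : ResidueField O') :
    r ∈ residueSubfield K O' ↔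
      ∃ (c : K) (h : algebraMap K L c ∈ O'), residue O' ⟨algebraMap K L c, h⟩ = r := by
  -- the set of residues is a subfield `T`
  let T : Subfield (ResidueField O') :=
    { carrier := {r | ∃ (c : K) (h : algebraMap K L c ∈ O'), residue O' ⟨algebraMap K L c, h⟩ = r}
      mul_mem' := by
        rintro _ _ ⟨c₁, h₁, rfl⟩ ⟨c₂, h₂, rfl⟩
        refine ⟨c₁ * c₂, by rw [map_mul]; exact mul_mem h₁ h₂, ?_⟩
        rw [← map_mul (residue O')]
        exact congrArg (residue O') (Subtype.ext (map_mul _ _ _))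
      one_mem' := by
        refine ⟨1, by rw [map_one]; exact one_mem _, ?_⟩
        have h1 : (⟨algebraMap K L 1, by rw [map_one]; exact one_mem _⟩ : O') = 1 :=
          Subtype.ext (map_one _)
        rw [h1, map_one]
      add_mem' := by
        rintro _ _ ⟨c₁, h₁, rfl⟩ ⟨c₂, h₂, rfl⟩
        refine ⟨c₁ + c₂, by rw [map_add]; exact add_mem h₁ h₂, ?_⟩
        rw [← map_add (residue O')]
        exact congrArg (residue O') (Subtype.ext (map_add _ _ _))
      zero_mem' := by
        refine ⟨0, by rw [map_zero]; exact zero_mem _, ?_⟩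
        have h0 : (⟨algebraMap K L 0, by rw [map_zero]; exact zero_mem _⟩ : O') = 0 :=
          Subtype.ext (map_zero _)
        rw [h0, map_zero]
      neg_mem' := by
        rintro _ ⟨c, h, rfl⟩
        refine ⟨-c, by rw [map_neg]; exact neg_mem h, ?_⟩
        rw [← map_neg (residue O')]
        exact congrArg (residue O') (Subtype.ext (map_neg _ _))
      inv_mem' := by
        rintro _ ⟨c, h, rfl⟩
        by_cases hr : residue O' ⟨algebraMap K L c, h⟩ = 0
        · refine ⟨0, by rw [map_zero]; exact zero_mem _, ?_⟩
          have h0 : (⟨algebraMap K L 0, by rw [map_zero]; exact zero_mem _⟩ : O') = 0 :=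
            Subtype.ext (map_zero _)
          rw [hr, inv_zero, h0, map_zero]
        · -- `c` is a unit of `K°`, and `c⁻¹` reduces to the inverse
          have hunit : IsUnit (⟨algebraMap K L c, h⟩ : O') := by
            by_contra hnu
            exact hr ((residue_eq_zero_iff _).mpr ((IsLocalRing.mem_maximalIdeal _).mpr hnu))
          have hc0 : algebraMap K L c ≠ 0 := fun h0 => hr (by
            have h1 : (⟨algebraMap K L c, h⟩ : O') = 0 := Subtype.ext h0
            rw [h1, map_zero])
          have hinv : (algebraMap K L c)⁻¹ ∈ O' := by
            have h1 : O'.valuation (algebraMap K L c) = 1 :=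
              (O'.valuation_eq_one_iff ⟨algebraMap K L c, h⟩).mp hunit
            refine (O'.valuation_le_one_iff _).mp ?_
            rw [map_inv₀, h1, inv_one]
          refine ⟨c⁻¹, by rw [map_inv₀]; exact hinv, ?_⟩
          apply eq_inv_of_mul_eq_one_left
          rw [← map_mul (residue O')]
          have hmul : (⟨algebraMap K L c⁻¹, by rw [map_inv₀]; exact hinv⟩ : O') *
              ⟨algebraMap K L c, h⟩ = 1 := Subtype.ext (by
            change algebraMap K L c⁻¹ * algebraMap K L c = 1
            rw [map_inv₀, inv_mul_cancel₀ hc0])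
          rw [hmul, map_one] }
  have hT : residueSubfield K O' = T :=
    le_antisymm (Subfield.closure_le.mpr fun r hr => hr) fun r hr => Subfield.subset_closure hr
  rw [hT]
  rfl

/-- **Inertia degree `f = f_{L/K} = [L̃ : K̃]`** (Temkin 2013, §2.1, p. 9; Kuhlmann 2010, p. 3:
"`fᵢ = [Lvᵢ : Kv]` are the respective inertia degrees") of `O' = L°` over `K`: the degree of the
residue field of `O'` over `K̃ ⊆ L̃` (Mathlib's `Module.finrank`, `0` if infinite; finite and
`≤ [L : K]` for `L/K` finite). [cite: Temkin2013, Section 2.1 (p. 9)] -/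
def inertiaDegree : ℕ :=
  Module.finrank (residueSubfield K O') (ResidueField O')

/-- The image `K' = ι(K) ⊆ L` is a subfield isomorphic to `K`, and `[L : K'] = [L : K]`.
[folklore] -/
theorem finrank_fieldRange_eq : Module.finrank ((algebraMap K L).fieldRange) L = Module.finrank K L :=
  (Algebra.finrank_eq_of_equiv_equiv
    (RingEquiv.ofBijective (algebraMap K L).rangeRestrictField
      (algebraMap K L).rangeRestrictField_bijective)
    (RingEquiv.refl L) (by ext c; rfl)).symm

/-- **The fundamental inequality `e·f ≤ n`** for ONE extension of the valuation (Temkin 2013,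
§2.1, p. 9: "An easy classical result states that `ef ≤ n`"): for `L/K` finite and any valuation
ring `O' = L°` of `L`, the index of `|K^×|` in `|L^×|` is finite, `L̃` is finite over `K̃`, and
`e_{L/K} · f_{L/K} ≤ [L : K]`. PROVED (`index_mul_finrank_le_finrank`, `FundamentalInequality.lean`).
[cite: Temkin2013, Section 2.1 (p. 9)] -/
theorem ramificationIndex_mul_inertiaDegree_le_finrank [FiniteDimensional K L] :
    (valueSubgroup K O').FiniteIndex ∧
      Module.Finite (residueSubfield K O') (ResidueField O') ∧
      ramificationIndex K O' * inertiaDegree K O' ≤ Module.finrank K L := by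
  let F : Subfield L := (algebraMap K L).fieldRange
  let i : K ≃+* F := RingEquiv.ofBijective (algebraMap K L).rangeRestrictField
    (algebraMap K L).rangeRestrictField_bijective
  haveI : Module.Finite F L :=
    Module.Finite.of_equiv_equiv i (RingEquiv.refl L) (by ext c; rfl)
  have hH : ∀ c : L, c ∈ F → (hc : c ≠ 0) →
      Units.mk0 (O'.valuation c) ((Valuation.ne_zero_iff _).mpr hc) ∈ valueSubgroup K O' := by
    rintro _ ⟨c₀, rfl⟩ hc
    have hc₀ : c₀ ≠ 0 := fun h => hc (by rw [h, map_zero])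
    exact (mem_valueSubgroup_iff K O' _).mpr ⟨c₀, hc₀, rfl⟩
  have hL : ∀ c : L, c ∈ F → (hc : c ∈ O') → residue O' ⟨c, hc⟩ ∈ residueSubfield K O' := by
    rintro _ ⟨c₀, rfl⟩ hc
    exact residue_mem_residueSubfield K O' c₀ hc
  obtain ⟨h1, h2, h3⟩ := index_mul_finrank_le_finrank O' F (valueSubgroup K O') hH
    (residueSubfield K O') hL
  refine ⟨h1, h2, ?_⟩
  rw [← finrank_fieldRange_eq K]
  exact h3

end Invariants

section Defectless

/-! Both notions of this section are DEFINITIONS — predicates on a valued field `(K, O)` with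
explicit binders (resp. on `(K, O)` and a finite extension `L`) — and not named facts: neither
is asserted to hold for every `(K, O)` (`not_forall_isDefectlessField`,
`ValuationDefectExample.lean`, refutes the universal closure of `IsDefectlessField` with
F. K. Schmidt's defect extension), and the published THEOREMS about them (the generalized
stability theorem `Kuhlmann2010Stability` below, Lemma 2.17, Cor. 2.16, …) are stated and proved
separately with these predicates as hypotheses / conclusions. -/

/-- **`(K, K°)` is defectless in the finite extension `L`** (Kuhlmann 2010, §1, p. 3: the
fundamental inequality "`n ≥ ∑_{i=1}^{g} eᵢ fᵢ` where `n = [L : K]` is the degree of the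
extension, `v₁, …, v_g` are the distinct extensions of `v` from `K` to `L`, `eᵢ = (vᵢL : vK)` are
the respective ramification indices and `fᵢ = [Lvᵢ : Kv]` are the respective inertia degrees …
We say that `(K, v)` is defectless in `L` if equality holds"; Temkin 2013, §2.1, p. 9: "If, more
generally, the valuation of `k` admits `m` extensions to `l` and `e₁, …, e_m, f₁, …, f_m` are the
corresponding invariants of the extensions of valued fields then `e₁f₁ + ⋯ + e_m f_m ≤ n` and the
extension is called defectless when equality holds"). Rendering: the (finitely many) extensions
of `K°` to `L` are the valuation rings `O'` of `L` with `O' ∩ K = K°`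
(`O'.comap (algebraMap K L) = O`); the statement packages their finiteness as the existence of a
finite set `s` consisting EXACTLY of them, with `∑_{O' ∈ s} e(O') f(O') = [L : K]`.
[cite: Kuhlmann2010, Section 1 (p. 3 of arXiv:1003.5678)] -/
def IsDefectlessIn (K : Type u) [Field K] (O : ValuationSubring K)
    (L : Type u) [Field L] [Algebra K L] : Prop :=
  ∃ s : Finset (ValuationSubring L),
    (∀ O' : ValuationSubring L, O' ∈ s ↔ O'.comap (algebraMap K L) = O) ∧
    ∑ O' ∈ s, ramificationIndex K O' * inertiaDegree K O' = Module.finrank K L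

/-- DEFINITION (a two-argument predicate `IsDefectlessField K O` on a field `K` with a valuation
ring `O = K°`; not a named fact) — **defectless (= stable) valued field**, as defined in
F.-V. Kuhlmann, *Elimination of ramification I: The generalized stability theorem*, Trans. Amer.
Math. Soc. 362 (2010), §1.1, p. 3 of arXiv:1003.5678: "`(K, v)` is called a defectless (or
stable) field if it is defectless in every finite extension `L` of `K`", and in M. Temkin,
*Inseparable local uniformization*, J. Algebra 373 (2013), §2.1, p. 9: "A valued field `k` is
called stable if any finite extension is defectless": for every finite extension `L/K`,
`(K, O)` is defectless in `L` (`IsDefectlessIn K O L`, i.e. `∑ᵢ eᵢ fᵢ = [L : K]` over the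
extensions of `O` to `L`). The predicate is satisfiable but not universally true: it HOLDS for
the trivial valuation `O = ⊤` (`isDefectlessField_top`, `ValuationDefectProofs.lean`; Kuhlmann,
loc. cit.: "Note that every trivially valued field is a defectless field") and for residue
characteristic `0` (`DefectlessResidueCharZero.lean`), and it FAILS for F. K. Schmidt's defect
example in characteristic `p` (`SchmidtDefect.not_isDefectlessField_adjoin`,
`exists_not_isDefectlessField`, `not_forall_isDefectlessField : ¬ ∀ K O, IsDefectlessField K O`
in `ValuationDefectExample.lean`). Verdict clean-up (2026-08-16): this declaration had been
indexed as a closed named fact awaiting a discharge `IsDefectlessField_holds : IsDefectlessField`,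
which is ill-typed (and whose universal closure is refuted, above); the body is unchanged and
only the binders `(K) [Field K] (O)` were moved from a `variable` line into the signature, so
every user `IsDefectlessField K O` is unaffected.
[cite: Kuhlmann2010, Section 1.1 (p. 3 of arXiv:1003.5678)] -/
def IsDefectlessField (K : Type u) [Field K] (O : ValuationSubring K) : Prop :=
  ∀ (L : Type u) [Field L] [Algebra K L], FiniteDimensional K L → IsDefectlessIn K O L

/-- Sanity check of the definitions on the trivial extension `L = K`: the only extension of `K°`
to `K` is `K°` itself, with `e = f = 1`, so `(K, K°)` is defectless in `K`. PROVED. [folklore] -/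
theorem isDefectlessIn_self (K : Type u) [Field K] (O : ValuationSubring K) :
    IsDefectlessIn K O K := by
  classical
  refine ⟨{O}, fun O' => ?_, ?_⟩
  · rw [Finset.mem_singleton]
    constructor
    · rintro rfl
      ext x
      simp
    · intro h
      rw [← h]
      ext x
      simp
  rw [Finset.sum_singleton, Module.finrank_self]
  -- `e = 1`: every value is the value of an element of `K`
  have he : ramificationIndex K O = 1 := by
    unfold ramificationIndex
    rw [Subgroup.index_eq_one]
    refine eq_top_iff.mpr fun γ _ => ?_
    obtain ⟨c, hc⟩ := O.valuation_surjective (γ : ValuationSubring.ValueGroup O)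
    have hc0 : c ≠ 0 := fun h => by
      rw [h, map_zero] at hc
      exact γ.ne_zero hc.symm
    exact (mem_valueSubgroup_iff K O γ).mpr ⟨c, hc0, hc.symm⟩
  -- `f = 1`: every residue is the residue of an element of `K`
  have hf : inertiaDegree K O = 1 := by
    unfold inertiaDegree
    have htop : residueSubfield K O = ⊤ := by
      refine eq_top_iff.mpr fun r _ => ?_
      obtain ⟨x, rfl⟩ := IsLocalRing.residue_surjective r
      exact residue_mem_residueSubfield K O (x : K) x.2
    rw [htop]
    have h := Algebra.finrank_eq_of_equiv_equiv
      (Subfield.topEquiv : (⊤ : Subfield (ResidueField O)) ≃+* ResidueField O)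
      (RingEquiv.refl (ResidueField O)) (by ext; rfl)
    rw [h, Module.finrank_self]
  rw [he, hf]

end Defectless

/-! ### The generalized stability theorem (named fact) -/

/-- NAMED FACT — **The generalized stability theorem over a trivially valued ground field**
(F.-V. Kuhlmann, *Elimination of ramification I: The generalized stability theorem*, Trans. AMS
362 (2010), Thm. 1.1: "Let `(F|K, v)` be a valued function field without transcendence defect.
If `(K, v)` is a defectless field, then `(F, v)` is a defectless field"; p. 3: "Note that every
trivially valued field is a defectless field"; Temkin 2013, Remark 2.1.3, p. 10: "We will also
need the following difficult result called the (generalized) stability theorem: if `k` is stable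
then `l` is stable [for a finitely generated Abhyankar extension `l/k`]. We refer to a very recent
paper [Kuh] for a proof"). Vendored in the case needed by Temkin 2013, §5 (`k` trivially valued,
hence defectless): if `K/k` is a finitely generated extension, `k ⊆ K°` (so `K/k` is a valued
function field over the trivially valued `k`) and the transcendence defect `D_{K/k}` vanishes
("without transcendence defect" = equality in the Abhyankar inequality, `transcendenceDefect`,
`TranscendenceDefect.lean`), then `(K, K°)` is a defectless (stable) valued field
(`IsDefectlessField`). Its printed proof (Kuhlmann 2010, §§2–5: ramification theory,
Artin–Schreier and Kummer extensions, henselian rationality) is not available in Mathlib. Users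
take `(h : Kuhlmann2010Stability)`. [cite: Kuhlmann2010, Thm. 1.1] -/
def Kuhlmann2010Stability : Prop :=
  ∀ (k K : Type u) [Field k] [Field K] [Algebra k K], (⊤ : IntermediateField k K).FG →
    ∀ (O : ValuationSubring K) (hk : ∀ c : k, algebraMap k K c ∈ O),
      transcendenceDefect k O hk = 0 → IsDefectlessField K O

end Literature.AlgebraicGeometry.Resolution
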